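import Literature.MathematicalPhysics.QuantumFieldTheory.Balaban1983to89.B9Eq316AveragingTransposeZdPrinted

/-!
# [4] (3.16) — THE GENUINE AVERAGING LETTER `Q*aQ` DOES NOT SEE A RESCALING OF THE TRACE: `withQQP ((c:ℂ) • τ) = withQQP τ` (`c ≠ 0` real)

Cell `pub-ymgap`, width seat `pub-ymgap-k0-s2-w1` (g5).  `--kind proof --supports stmt-QuantumFields-20541` (count-neutral helper).
[4] = [Balaban1985BackgroundPropagators]; [5] = [Balaban1985Averaging].

WHY.  Print's fibre pairing is the NORMALISED trace, [4] p. 391 L31–32 → p. 392 L2 «X·Y = tr XY … tr 1 = 1», i.e. `tr = Tr∕N` on `M_N(ℂ)`;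
the K0 end of the cube road «D3γ′» (`Summits/…/BalabanUVNodesK0Stub2OfSockGammaAvg.lean`, p599633 ∕ p607171) reads dag-n06-b's objects at
`τ := Tr` (UNNORMALISED, `C_τ = 2`) and DISPLAYS its invertibility binder `InvAt` at the genuine letter `withQQP Tr …`.  Referee ref-O g7
READ-188 NIT (1): the remark «a transpose does not change when its form is rescaled by a positive constant» was UNTYPED — a supplier of
`InvAt` written at print's `tr` would meet the letter `withQQP Tr …` only through that remark.  THIS FILE TYPES IT: for every real `c ≠ 0`
the τ-transpose `entryT`, hence `linCovIterT` (`Q_jᵀ`), the letter `QQZdP` (`Q*aQ`, edition P) and the letter family `withQQP` are THE SAME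
at `(c:ℂ) • τ` and at `τ`; in particular at `c = N⁻¹` (print's `tr`) and `τ = Tr`.

WHAT THIS FILE PROVES (theorems only; 0 `def`; nothing of dag-n06-b's modules edited or restated; nothing of Bałaban asserted).
§1 `tauForm_real_smul_apply` — `⟨x, y⟩_{c•τ} = c·⟨x, y⟩_τ`; `tauForm_nondegenerate_real_smul_iff` — nondegeneracy is scale-invariant (`c ≠ 0`);
   `tauForm_entryT_basis` — the defining pairing identity of `entryT` against the canonical basis (any map `E`, nondegenerate pairing).
§2 ★ `entryT_real_smul_tau` — `entryT ((c:ℂ) • τ) = entryT τ` (`c ≠ 0`): both candidates have the same pairings against the canonical basis, and the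
   pairing separates points; in the degenerate case both are `0` by the convention of `entryT`.
§3 `linCovIterT_real_smul_tau` ∕ `QQZdP_real_smul_tau` ∕ ★ `withQQP_real_smul_tau` — the transposed averaging, the genuine letter and the letter family
   are unchanged under `τ ↦ (c:ℂ) • τ`; `withQQP_inv_natCast_smul_tau` — the instance `c = n⁻¹` (`n ≠ 0`): print's normalised trace `n⁻¹ • Tr`
   meets the SAME letter as `Tr`.
NOT HERE: the fibre constants `C_τ`, `β_τ` (`betaTau`) DO depend on the scale (bookkeeping functions of the chosen `τ`, as p607171's header says);
no estimate; no statement about `InvAt` itself (it is displayed at a letter, and the letter is now scale-free by name).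

HONEST FRAMING: finite-dimensional linear algebra on dag-n06-b's definitions (`tauForm`, `entryT`, `linCovIterT`, `QQZdP`, `withQQP`); no Bałaban
estimate; V19's stub 2′ is already CLOSED by name (p595104) and this moves nothing on K0⁷ stmt-QuantumFields-20541 (OPEN: stubs 1 ∧ 3ᴬ′); counts
unmoved (typed 28∕28 · discharged 5∕27); one finite 𝕋⁴ programme at fixed ε, Bałaban AS PRINTED — the Yang–Mills mass gap (Clay) is NOT proved by any
of this; route R4 closes the CONDITIONAL finite-𝕋⁴ rung `BalabanLadder.UV` only.  No `sorry`, `def`, `instance`, `notation`; standard axioms.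
-/

noncomputable section

open scoped BigOperators

namespace Literature.MathematicalPhysics.QuantumFieldTheory.Balaban1983to89.B9Eq316AveragingTransposeScale

open B9Eq316AveragingTransposeZd (tauForm tauForm_apply entryT linCovIterT)
open B9Eq316AveragingTransposeZdPrinted (QQZdP withQQP)
open B8LeafModelZd (ZdIdx)
open B9SupplySockB9P3ZdLetters (OpsZd)

-- `Site` = the `ℤ^d` sites of `B7Prop1Explicit` (as in the source modules).
export B7Prop1Explicit (Site)

variable {d : ℕ} {𝔸 : Type*} [CStarAlgebra 𝔸]
variable (τ : 𝔸 →ₗ[ℂ] ℂ)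

/-! ## §1 The fibre pairing under `τ ↦ (c:ℂ) • τ` -/

/-- `⟨x, y⟩_{c•τ} = c·⟨x, y⟩_τ` for a real scale `c` (print's `tr = Tr∕N` is the case `c = N⁻¹`).
[cite: Balaban1985BackgroundPropagators, p.391 («X·Y = tr XY», «the trace is normalized, i.e., tr 1 = 1»)] -/
@[simp] theorem tauForm_real_smul_apply (c : ℝ) (x y : 𝔸) :
    tauForm ((c : ℂ) • τ) x y = c * tauForm τ x y := by
  rw [tauForm_apply, tauForm_apply, LinearMap.smul_apply, smul_eq_mul, Complex.re_ofReal_mul]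

/-- Nondegeneracy of the fibre pairing is invariant under a nonzero real rescaling of `τ`.
[cite: Balaban1985BackgroundPropagators, p.391 («X·Y = tr XY»)] -/
theorem tauForm_nondegenerate_real_smul_iff {c : ℝ} (hc : c ≠ 0) :
    (tauForm ((c : ℂ) • τ)).Nondegenerate ↔ (tauForm τ).Nondegenerate := by
  constructor
  · rintro ⟨hl, hr⟩
    refine ⟨fun x hx => hl x fun y => ?_, fun y hy => hr y fun x => ?_⟩
    · rw [tauForm_real_smul_apply, hx y, mul_zero]
    · rw [tauForm_real_smul_apply, hy x, mul_zero]
  · rintro ⟨hl, hr⟩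
    refine ⟨fun x hx => hl x fun y => ?_, fun y hy => hr y fun x => ?_⟩
    · have h := hx y
      rw [tauForm_real_smul_apply] at h
      exact (mul_eq_zero.1 h).resolve_left hc
    · have h := hy x
      rw [tauForm_real_smul_apply] at h
      exact (mul_eq_zero.1 h).resolve_left hc

variable [FiniteDimensional ℝ 𝔸]

/-- The defining pairing identity of the τ-transpose against the canonical basis: `⟨Eᵀv, b_j⟩_τ = ⟨v, E b_j⟩_τ` for EVERY map `E : 𝔸 → 𝔸`
(no linearity asked) as soon as the pairing is nondegenerate. [cite: Balaban1985BackgroundPropagators, (3.16) p.393 («an operator Q*aQ»)] -/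
theorem tauForm_entryT_basis (hN : (tauForm τ).Nondegenerate) (E : 𝔸 → 𝔸) (v : 𝔸) (j : Fin (Module.finrank ℝ 𝔸)) :
    tauForm τ (entryT τ E v) (Module.finBasis ℝ 𝔸 j) = tauForm τ v (E (Module.finBasis ℝ 𝔸 j)) := by
  classical
  unfold entryT
  rw [dif_pos hN, map_sum, LinearMap.sum_apply]
  simp_rw [map_smul, LinearMap.smul_apply, smul_eq_mul, LinearMap.BilinForm.apply_dualBasis_left]
  rw [Finset.sum_eq_single j]
  · rw [if_pos rfl, mul_one]
  · intro i _ hij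
    rw [if_neg (fun h => hij h.symm), mul_zero]
  · intro hj
    exact absurd (Finset.mem_univ j) hj

/-! ## §2 The τ-transpose is scale-free -/

/-- ★ **THE τ-TRANSPOSE DOES NOT SEE A RESCALING OF ITS FORM**: `entryT ((c:ℂ) • τ) = entryT τ` for every real `c ≠ 0` — a transpose with respect to
the form `c·⟨·,·⟩_τ` is the transpose with respect to `⟨·,·⟩_τ` (the dual basis rescales by `c⁻¹`, the coefficients by `c`); in the degenerate case both
sides are `0` by convention. [cite: Balaban1985BackgroundPropagators, (3.16) p.393 («an operator Q*aQ»), p.391 («tr 1 = 1»)] -/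
theorem entryT_real_smul_tau {c : ℝ} (hc : c ≠ 0) : entryT ((c : ℂ) • τ) = entryT τ := by
  classical
  funext E v
  by_cases hN : (tauForm τ).Nondegenerate
  · have hN' : (tauForm ((c : ℂ) • τ)).Nondegenerate := (tauForm_nondegenerate_real_smul_iff τ hc).2 hN
    -- both candidates have the same `τ`-pairings against the canonical basis
    have key : tauForm τ (entryT ((c : ℂ) • τ) E v) = tauForm τ (entryT τ E v) := by
      refine (Module.finBasis ℝ 𝔸).ext fun j => ?_
      have h1 : tauForm ((c : ℂ) • τ) (entryT ((c : ℂ) • τ) E v) (Module.finBasis ℝ 𝔸 j) =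
          tauForm ((c : ℂ) • τ) v (E (Module.finBasis ℝ 𝔸 j)) := tauForm_entryT_basis ((c : ℂ) • τ) hN' E v j
      rw [tauForm_real_smul_apply, tauForm_real_smul_apply] at h1
      rw [tauForm_entryT_basis τ hN E v j]
      exact mul_left_cancel₀ hc h1
    -- and the pairing separates points
    have hsep : ∀ y, tauForm τ (entryT ((c : ℂ) • τ) E v - entryT τ E v) y = 0 := fun y => by
      rw [map_sub, LinearMap.sub_apply, key, sub_self]
    exact sub_eq_zero.1 (hN.1 _ hsep)
  · have hN' : ¬ (tauForm ((c : ℂ) • τ)).Nondegenerate := fun h => hN ((tauForm_nondegenerate_real_smul_iff τ hc).1 h)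
    unfold entryT
    rw [dif_neg hN', dif_neg hN]

/-! ## §3 The transposed averaging `Q_jᵀ`, the genuine letter `Q*aQ` (edition P) and the letter family `withQQP` are scale-free -/

/-- `Q_jᵀ` at `(c:ℂ) • τ` is `Q_jᵀ` at `τ`. [cite: Balaban1985BackgroundPropagators, (3.16) p.393; Balaban1985Averaging, (147) p.40] -/
theorem linCovIterT_real_smul_tau {c : ℝ} (hc : c ≠ 0) (L : ℕ) (U₀ : Site d → Fin d → 𝔸ˣ) (j : ℕ) (B : Site d → Fin d → 𝔸)
    (y : Site d) (μ : Fin d) :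
    linCovIterT ((c : ℂ) • τ) L U₀ j B y μ = linCovIterT τ L U₀ j B y μ := by
  unfold linCovIterT
  rw [entryT_real_smul_tau τ hc]

/-- The genuine averaging letter `Q*aQ` (edition P) at `(c:ℂ) • τ` is the one at `τ`. [cite: Balaban1985BackgroundPropagators, (3.16) p.393, (3.26) p.395] -/
theorem QQZdP_real_smul_tau {c : ℝ} (hc : c ≠ 0) (L : ℕ) (ΛbP : ℕ → ℕ → Set (Site d × Fin d)) (i : ZdIdx d L) (m : ℕ) :
    QQZdP ((c : ℂ) • τ) L ΛbP i m = QQZdP τ L ΛbP i m := by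
  funext U₀ A y μ
  unfold QQZdP
  simp only [linCovIterT_real_smul_tau τ hc]

/-- ★ **THE LETTER FAMILY WITH THE GENUINE `Q*aQ` IS SCALE-FREE**: `withQQP ((c:ℂ) • τ) L ΛbP ops₀ = withQQP τ L ΛbP ops₀` (`c ≠ 0` real) — so every
binder displayed AT the letter (e.g. `InvAt … (withQQP τ …)`, [4] (3.27) for (3.26)) is literally the same binder at `(c:ℂ) • τ`.
[cite: Balaban1985BackgroundPropagators, (3.26)–(3.27) p.395, (3.16) p.393, p.391 («tr 1 = 1»)] -/
theorem withQQP_real_smul_tau {c : ℝ} (hc : c ≠ 0) (L : ℕ) (ΛbP : ℕ → ℕ → Set (Site d × Fin d))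
    (ops₀ : ℝ → ZdIdx d L → ℕ → OpsZd d 𝔸) :
    withQQP ((c : ℂ) • τ) L ΛbP ops₀ = withQQP τ L ΛbP ops₀ := by
  funext M i m
  unfold withQQP
  rw [QQZdP_real_smul_tau τ hc]

/-- **PRINT'S NORMALISED TRACE MEETS THE SAME LETTER**: for `n ≠ 0`, `withQQP ((n⁻¹:ℂ) • τ) … = withQQP τ …` — with `τ = Tr` on `M_n(ℂ)` the left letter is
the one written at print's `tr = Tr∕n` («tr 1 = 1»), the right one the letter at which p607171 ∕ p598773 display `InvAt`.
[cite: Balaban1985BackgroundPropagators, p.391 L31–32 and p.392 L2 («X·Y = tr XY», «tr 1 = 1»), (3.16) p.393] -/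
theorem withQQP_inv_natCast_smul_tau {n : ℕ} (hn : n ≠ 0) (L : ℕ) (ΛbP : ℕ → ℕ → Set (Site d × Fin d))
    (ops₀ : ℝ → ZdIdx d L → ℕ → OpsZd d 𝔸) :
    withQQP ((((n : ℝ)⁻¹ : ℝ) : ℂ) • τ) L ΛbP ops₀ = withQQP τ L ΛbP ops₀ :=
  withQQP_real_smul_tau τ (inv_ne_zero (Nat.cast_ne_zero.2 hn)) L ΛbP ops₀

end Literature.MathematicalPhysics.QuantumFieldTheory.Balaban1983to89.B9Eq316AveragingTransposeScale

end
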